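/-
Copyright (c) 2026. All rights reserved.
Released under Apache 2.0 license as described in the file LICENSE.
Authors: abc-iut cell, wave-4 seat abc-iut-w4-d059 (proof-only; T54-B, the tempered instantiation of the
(AI4″) producer: the BRANCH dictionary of the arithmetic decomposition groups at the standard branch class).
-/
import Literature.AnabelianGeometry.SemiGraphs.ArithVertGpNormalizerDictionary
import Literature.AnabelianGeometry.SemiGraphs.SubgroupPresentationArithStabilizers2
import Literature.AnabelianGeometry.SemiGraphs.TemperedMaximalCompact
import Literature.AnabelianGeometry.SemiGraphs.TemperedEdgeLikeCommensurable
import HarnessLib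

/-!
# [SemiAnbd] §5 p. 65 / Thm 5.4 (i) p. 66: the arithmetic branch group `Π^temp_{𝔊,b}` and the standard
# branch class of the coset levels — both directions of the dictionary (proof-only)

Mochizuki, *Semi-graphs of anabelioids*, Publ. RIMS **42** (2006), §5 p. 65 ("`Π^temp_{𝔊,b} ⊆ Π^temp_{𝔊,v}`
… the commensurator in `Π^temp_{𝔊,v}` of `Π^temp_{𝔾,b}`"), proof of Thm 3.7 (iii) p. 41 ("since `𝒢` is
totally estranged, `H` fixes precisely one branch") and Thm 5.4 (i) p. 66 ("entirely parallel")
[cite: MochizukiSemiAnbd2006, §5 p.65].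

PROOF-ONLY file (abc-iut cell, producer row T54-B, «T54·stabBranchPairAug-ASSEMBLY», seat abc-iut-w4-d059).
Setting of `ArithVertGpNormalizerDictionary.lean`, with the representatives matched to the presentation
also at the branches (`hRcB : Rc.Hb b = s_b M_{e(b)} s_b⁻¹`).  The two BRANCH inputs of abc-iut-w4-d059's
`map_aug_le_conj_of_levelDict'` for the arithmetic branch group
`arithBrGp Rc ι b₀ = Π^temp_{𝔊,v₀} ∩ C_E(ι(s_{b₀} M s_{b₀}⁻¹))` and the standard branch classes
`κ_j := (b₀, M s_{b₀}⁻¹ N_j)` at the standard vertex `H_{v₀} · 1 · N_j`: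

* `mem_arithBrGp_of_fixes_bMk` (= `hκE'`): an element of `Π^temp_{𝔊,v₀}` fixing `κ_j` at EVERY level lies
  in `Π^temp_{𝔊,b₀}` — by abc-iut-w4-d059's (E-B″) `exists_conj_s_mem_M_of_fixes_bMk` applied to `v` and
  `v⁻¹` (`Φ_v(s M s⁻¹) = s M s⁻¹`, so `v` normalises `ι(s M s⁻¹)`), modulo the separation input `hsep`
  (discharged at the canonical tower from `hfree` + `hMK`, see `ArithBranchPairAugCosetTower.lean`);
* `arithBrGp_fixes_bMk` (with `arithVertGp_fixes_vMk`, = `hκV`): every element `v` of `Π^temp_{𝔊,b₀}` FIXES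
  `κ_j` at every level — if not, the compact subgroup `s M s⁻¹ ∩ Φ_v(s M s⁻¹)` of `π₁^temp(𝒢)` (of finite index
  in the infinite `s M s⁻¹` by commensurability, hence `≠ 1`, Cor 3.9 `infinite_of_mem_edgeLikeSubgroups`)
  fixes the compatible branch PAIR `(κ_j, v·κ_j)` at the standard vertex, contradicting the estrangement
  consequence `hnobp` (the capstone binder `hnobpNCpt`, PRODUCED at the canonical tower by abc-iut-w4-d083's
  `hnobpNCpt_cosetTower_holds`).

No definition, no new named fact; nothing here takes a side on [IUTchIII] Cor. 3.12.
-/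

namespace Literature.AnabelianGeometry.SemiGraphs

namespace ProfiniteSemiGraph

open CategoryTheory Topology
open scoped Pointwise

universe u v

variable {𝒢 : ProfiniteSemiGraph.{u}} (c : TemperedPiChart 𝒢)
  (P : SemiGraph.SubgroupPresentation 𝒢.graph c.G)
  {E : Type v} [Group E] {Φ : E →* MulAut c.G} {σ : E →* Aut 𝒢.graph} (hP : P.IsArithCompatible Φ σ)
  (ι : c.G →* E) (hι : Function.Injective ι)
  (hιconj : ∀ (e : E) (x : c.G), e * ι x * e⁻¹ = ι (Φ e x))
  (hιΦ : ∀ g : c.G, Φ (ι g) = MulAut.conj g) (hισ : ∀ g : c.G, σ (ι g) = 1)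
  (hPH : ∀ w, P.H w ∈ verticialSubgroups c w) (hPM : ∀ e, P.M e ∈ edgeLikeSubgroups c e)
  (Rc : ChartRepresentatives c) (hRcV : ∀ v, Rc.Hv v = P.H v)
  (hRcB : ∀ b, Rc.Hb b = (P.M (𝒢.graph.edgeOf b)).map (MulAut.conj (P.s b)).toMonoidHom)

/-! ### Fixing the standard branch class at every level ⇒ membership (`hκE'`) -/

include hP hι hιconj hPH hRcV hRcB in
/-- **`hκE'`: an element of `Π^temp_{𝔊,v₀}` fixing the standard branch class `(b₀, M s_{b₀}⁻¹ N_n)` at every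
level of a `Φ`-stable normal family lies in `Π^temp_{𝔊,b₀}`**, modulo the separation input `hsep` of
(E-B″). [cite: MochizukiSemiAnbd2006, §5 p.65] -/
theorem mem_arithBrGp_of_fixes_bMk (h37 : 𝒢.Thm37Hypotheses) {ιN : Type*} [Nonempty ιN]
    (Ns : ιN → Subgroup c.G) [∀ n, (Ns n).Normal]
    (hNs : ∀ (n : ιN) (e : E) (x : c.G), x ∈ Ns n → Φ e x ∈ Ns n)
    {v₀ : 𝒢.graph.Vertex} {b₀ : 𝒢.graph.Branch} (hb₀ : 𝒢.graph.abuts b₀ = some v₀)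
    {v : E} (hv : v ∈ arithVertGp Rc ι v₀)
    (hfix : ∀ n, (P.arithAct hP (Ns n) (hNs n) v).hom.branchMap (P.bMk (Ns n) b₀ (P.s b₀)⁻¹) =
      P.bMk (Ns n) b₀ (P.s b₀)⁻¹)
    (hsep : ∀ c ∈ P.H v₀, (∀ n, ∃ μ ∈ P.M (𝒢.graph.edgeOf b₀), ∃ y ∈ Ns n,
      c = P.s b₀ * μ * (P.s b₀)⁻¹ * y) → ∃ μ ∈ P.M (𝒢.graph.edgeOf b₀), c = P.s b₀ * μ * (P.s b₀)⁻¹) :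
    v ∈ arithBrGp Rc ι b₀ := by
  rw [arithBrGp_of_abuts Rc ι hb₀]
  refine Subgroup.mem_inf.mpr ⟨hv, ?_⟩
  set s := P.s b₀ with hs_def
  -- `v` and `v⁻¹` normalise `H_{v₀}` through `Φ`
  obtain ⟨-, hV⟩ := sigma_fix_and_isVConj_one_of_mem_arithVertGp c P hP ι hι hιconj hPH Rc hRcV h37 hv
  obtain ⟨-, hV'⟩ :=
    sigma_fix_and_isVConj_one_of_mem_arithVertGp c P hP ι hι hιconj hPH Rc hRcV h37 (Subgroup.inv_mem _ hv)
  -- `v⁻¹` fixes the standard branch classes too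
  have hfix' : ∀ n, (P.arithAct hP (Ns n) (hNs n) v⁻¹).hom.branchMap (P.bMk (Ns n) b₀ s⁻¹) =
      P.bMk (Ns n) b₀ s⁻¹ := by
    intro n
    conv_lhs => rw [← hfix n]
    rw [← SemiGraph.aut_mul_branchMap, ← map_mul, inv_mul_cancel, map_one]
    rfl
  -- (E-B″) for `v` and for `v⁻¹`
  have h₁ := P.exists_conj_s_mem_M_of_fixes_bMk hP Ns hNs hb₀ v hV hfix hsep
  have h₂ := P.exists_conj_s_mem_M_of_fixes_bMk hP Ns hNs hb₀ v⁻¹ hV' hfix' hsep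
  -- `Φ_v (s M s⁻¹) = s M s⁻¹`
  have hmap : ((P.M (𝒢.graph.edgeOf b₀)).map (MulAut.conj s).toMonoidHom).map (Φ v).toMonoidHom =
      (P.M (𝒢.graph.edgeOf b₀)).map (MulAut.conj s).toMonoidHom := by
    ext y
    simp only [Subgroup.mem_map, MulEquiv.coe_toMonoidHom, MulAut.conj_apply, exists_exists_and_eq_and]
    constructor
    · rintro ⟨x, hx, rfl⟩
      obtain ⟨x', hx', h⟩ := h₁ x hx
      exact ⟨x', hx', h.symm⟩
    · rintro ⟨x, hx, rfl⟩
      obtain ⟨x', hx', h⟩ := h₂ x hx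
      refine ⟨x', hx', ?_⟩
      rw [← h, ← MulAut.mul_apply, ← map_mul, mul_inv_cancel, map_one, MulAut.one_apply]
  rw [Subgroup.Commensurable.commensurator_mem_iff, hRcB, conjAct_smul_map_eq_map_map c ι hιconj, hmap]

/-! ### Membership ⇒ fixing the standard branch class (`hκV`), from the estrangement consequence -/

variable (L : ℕ → Subgroup c.G) [∀ j, (L j).Normal] (hL : ∀ ⦃i j : ℕ⦄, i ≤ j → L j ≤ L i)
  (hLst : ∀ (j : ℕ) (e : E) (x : c.G), x ∈ L j → Φ e x ∈ L j)

omit [∀ j, (L j).Normal] in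
/-- The elements of `s_{b₀} M s_{b₀}⁻¹` fix the standard branch class `(b₀, M s_{b₀}⁻¹ K)` under the deck
action. [cite: MochizukiSemiAnbd2006, Thm 3.7(iii) p.41] -/
theorem deckAct_fixes_bMk_of_mem_conj (K : Subgroup c.G) [K.Normal] {b₀ : 𝒢.graph.Branch} {g : c.G}
    (hg : g ∈ (P.M (𝒢.graph.edgeOf b₀)).map (MulAut.conj (P.s b₀)).toMonoidHom) :
    (P.deckAct K g).hom.branchMap (P.bMk K b₀ (P.s b₀)⁻¹) = P.bMk K b₀ (P.s b₀)⁻¹ := by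
  obtain ⟨m, hm, rfl⟩ := hg
  rw [P.deckAct_branchMap_bMk]
  refine Subtype.ext (Prod.ext rfl (congrArg (Sigma.mk (𝒢.graph.edgeOf b₀)) ?_))
  exact (DoubleCoset.eq _ _ _ _).mpr ⟨m, hm, 1, one_mem _, by simp [mul_assoc]⟩

include hP hι hιconj hιΦ hισ hPH hPM hRcV hRcB hL in
/-- **`hκV` (branch part): every element of `Π^temp_{𝔊,b₀}` fixes the standard branch class
`(b₀, M s_{b₀}⁻¹ L_j)` at every level** of an antitone `Φ`-stable normal family, granted the estrangement
consequence `hnobp` at these levels (no compact `C ≠ 1` of `π₁^temp(𝒢)` fixes a compatible branch pair):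
otherwise `s M s⁻¹ ∩ Φ_v(s M s⁻¹)` is such a `C` for the pair `(κ_j, v·κ_j)_{j ≥ j₁}`, and it is `≠ 1` because
it has finite index in the infinite `s M s⁻¹` (commensurability). `Φ_e` is required to be continuous
(`hΦc`). [cite: MochizukiSemiAnbd2006, Thm 5.4 (i) p.66] -/
theorem arithBrGp_fixes_bMk (h37 : 𝒢.Thm37Hypotheses) (hΦc : ∀ e : E, Continuous (Φ e))
    (hnobp : ∀ (C : Subgroup c.G), IsCompact (C : Set c.G) →
      ∀ (j₀ : ℕ) (w : ∀ i : {i : ℕ // j₀ ≤ i}, (P.cosetGraph (L i.1)).Vertex)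
      (β β' : ∀ i : {i : ℕ // j₀ ≤ i}, (P.cosetGraph (L i.1)).Branch),
      (∀ i, β i ≠ β' i ∧ (P.cosetGraph (L i.1)).abuts (β i) = some (w i) ∧
        (P.cosetGraph (L i.1)).abuts (β' i) = some (w i)) →
      (∀ ⦃i i' : {i : ℕ // j₀ ≤ i}⦄ (h : i.1 ≤ i'.1), (P.cosetGraphTrans (hL h)).vertexMap (w i') = w i ∧
        (P.cosetGraphTrans (hL h)).branchMap (β i') = β i ∧
          (P.cosetGraphTrans (hL h)).branchMap (β' i') = β' i) →
      (∀ (i : {i : ℕ // j₀ ≤ i}) (γ : C), (P.arithAct hP (L i.1) (hLst i.1) (ι γ)).hom.vertexMap (w i) = w i ∧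
        (P.arithAct hP (L i.1) (hLst i.1) (ι γ)).hom.branchMap (β i) = β i ∧
          (P.arithAct hP (L i.1) (hLst i.1) (ι γ)).hom.branchMap (β' i) = β' i) → C = ⊥)
    {v₀ : 𝒢.graph.Vertex} {b₀ : 𝒢.graph.Branch} (hb₀ : 𝒢.graph.abuts b₀ = some v₀)
    {v : E} (hv : v ∈ arithBrGp Rc ι b₀) (j : ℕ) :
    (P.arithAct hP (L j) (hLst j) v).hom.branchMap (P.bMk (L j) b₀ (P.s b₀)⁻¹) = P.bMk (L j) b₀ (P.s b₀)⁻¹ := by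
  classical
  haveI := c.t2Space
  by_contra hne
  set s := P.s b₀ with hs_def
  set Mb : Subgroup c.G := (P.M (𝒢.graph.edgeOf b₀)).map (MulAut.conj s).toMonoidHom with hMb_def
  have hMb : Mb ∈ edgeLikeSubgroups c (𝒢.graph.edgeOf b₀) := conj_mem_edgeLikeSubgroups' c (hPM _) s
  have hvV : v ∈ arithVertGp Rc ι v₀ := arithBrGp_le_arithVertGp Rc ι hb₀ hv
  have hvM : v ∈ Subgroup.Commensurable.commensurator (Mb.map ι) := by
    rw [arithBrGp_of_abuts Rc ι hb₀, hRcB] at hv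
    exact hv.2
  -- the standard vertex is fixed by `v` at every level
  have hω : ∀ i, (P.arithAct hP (L i) (hLst i) v).hom.vertexMap (P.vMk (L i) v₀ 1) = P.vMk (L i) v₀ 1 :=
    fun i => arithVertGp_fixes_vMk c P hP ι hι hιconj hPH Rc hRcV (L i) (hLst i) hιΦ hισ h37 hvV
  -- the reference branch classes and their `v`-translates
  let κ : ∀ i : ℕ, (P.cosetGraph (L i)).Branch := fun i => P.bMk (L i) b₀ s⁻¹
  let γ : ∀ i : ℕ, (P.cosetGraph (L i)).Branch := fun i => (P.arithAct hP (L i) (hLst i) v).hom.branchMap (κ i)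
  have hκabuts : ∀ i, (P.cosetGraph (L i)).abuts (κ i) = some (P.vMk (L i) v₀ 1) := fun i => by
    show (P.cosetGraph (L i)).abuts (P.bMk (L i) b₀ s⁻¹) = _
    rw [P.cosetGraph_abuts_bMk (L i) b₀ v₀ hb₀, hs_def, mul_inv_cancel]
  have hγabuts : ∀ i, (P.cosetGraph (L i)).abuts (γ i) = some (P.vMk (L i) v₀ 1) := fun i => by
    have := (P.arithAct hP (L i) (hLst i) v).hom.abuts_branchMap (κ i) _ (hκabuts i)
    rwa [hω i] at this
  -- naturality of `γ` under the transitions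
  have hγtrans : ∀ ⦃i i' : ℕ⦄ (h : i ≤ i'), (P.cosetGraphTrans (hL h)).branchMap (γ i') = γ i := by
    intro i i' h
    have := congrArg (fun f : P.cosetGraph (L i') ⟶ P.cosetGraph (L i) => f.branchMap (κ i'))
      (P.arithAct_trans hP (hLst i') (hLst i) (hL h) v)
    exact this
  -- `Mb` fixes the standard vertex and the reference branch classes
  have hMbH : Mb ≤ P.H v₀ := by
    rintro _ ⟨m, hm, rfl⟩
    exact P.conj_mem b₀ v₀ hb₀ m hm
  have hMbω : ∀ i, ∀ g ∈ Mb, (P.arithAct hP (L i) (hLst i) (ι g)).hom.vertexMap (P.vMk (L i) v₀ 1) =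
      P.vMk (L i) v₀ 1 := fun i g hg => by
    rw [P.arithAct_eq_deckAct_of_inner hP (L i) (hLst i) (hιΦ g) (hισ g)]
    exact P.deckAct_vMk_one_of_mem_H (L i) v₀ (hMbH hg)
  have hMbκ : ∀ i, ∀ g ∈ Mb, (P.arithAct hP (L i) (hLst i) (ι g)).hom.branchMap (κ i) = κ i := fun i g hg => by
    rw [P.arithAct_eq_deckAct_of_inner hP (L i) (hLst i) (hιΦ g) (hισ g)]
    exact deckAct_fixes_bMk_of_mem_conj c P (L i) hg
  -- the compact subgroup `C := Mb ∩ Φ_v(Mb)`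
  let C : Subgroup c.G := Mb ⊓ Mb.map (Φ v).toMonoidHom
  have hMbc : IsCompact (Mb : Set c.G) := isCompact_of_mem_edgeLikeSubgroups c hMb
  have hCc : IsCompact (C : Set c.G) := by
    show IsCompact ((Mb ⊓ Mb.map (Φ v).toMonoidHom : Subgroup c.G) : Set c.G)
    rw [Subgroup.coe_inf, Subgroup.coe_map]
    exact hMbc.inter_right ((hMbc.image (hΦc v)).isClosed)
  -- `C` fixes the compatible branch pair `(κ, γ)` at the standard vertex, from level `j` on
  have hCbot : C = ⊥ := by
    refine hnobp C hCc j (fun i => P.vMk (L i.1) v₀ 1) (fun i => κ i.1) (fun i => γ i.1)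
      (fun i => ⟨?_, hκabuts i.1, hγabuts i.1⟩) (fun i i' h => ⟨rfl, rfl, hγtrans h⟩) ?_
    · -- `κ_i ≠ γ_i` for `i ≥ j`: otherwise `κ_j = γ_j`
      intro h
      apply hne
      have := congrArg (P.cosetGraphTrans (hL i.2)).branchMap h
      rw [hγtrans i.2] at this
      exact this.symm
    · rintro i ⟨g, hgM, hgΦ⟩
      refine ⟨hMbω i.1 g hgM, hMbκ i.1 g hgM, ?_⟩
      -- `g = Φ_v x` with `x ∈ Mb`: `ι g = v ι(x) v⁻¹` fixes `γ_i = v · κ_i`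
      obtain ⟨x, hx, rfl⟩ := hgΦ
      show (P.arithAct hP (L i.1) (hLst i.1) (ι (Φ v x))).hom.branchMap
          ((P.arithAct hP (L i.1) (hLst i.1) v).hom.branchMap (κ i.1)) =
        (P.arithAct hP (L i.1) (hLst i.1) v).hom.branchMap (κ i.1)
      rw [← hιconj, map_mul, map_mul, SemiGraph.aut_mul_branchMap, SemiGraph.aut_mul_branchMap,
        ← SemiGraph.aut_mul_branchMap (P.arithAct hP (L i.1) (hLst i.1) v⁻¹), ← map_mul, inv_mul_cancel,
        map_one, SemiGraph.aut_one_branchMap, hMbκ i.1 x hx]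
  -- but `C` has finite index in the infinite `Mb`: contradiction
  have hcomm : Subgroup.Commensurable (Mb.map (Φ v).toMonoidHom) Mb := by
    have h := (Subgroup.Commensurable.commensurator_mem_iff _ _).mp hvM
    rw [conjAct_smul_map_eq_map_map c ι hιconj] at h
    obtain ⟨h1, h2⟩ := h
    rw [Subgroup.relIndex_map_map_of_injective _ _ hι] at h1 h2
    exact ⟨h1, h2⟩
  haveI := infinite_of_mem_edgeLikeSubgroups verticialInjective_holds h37 c hMb
  have h1 := hcomm.1
  rw [← Subgroup.inf_relIndex_left, show Mb ⊓ Mb.map (Φ v).toMonoidHom = ⊥ from hCbot,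
    Subgroup.relIndex_bot_left] at h1
  exact h1 Nat.card_eq_zero_of_infinite

end ProfiniteSemiGraph

end Literature.AnabelianGeometry.SemiGraphs
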